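import Mathlib
import HarnessLib.Audit
import Summits.PneNP.PneNP.Theorems.ClusOshTau

/-!
# Route ClusUniversalCertificate — F4, second pointwise bound: `def_Y(y) ≤ |supp y|` (osh-P2.md §2 F4 "G2 ≥ 0")
(rung F-N1, cell pnp-ideate, crux `UniversalCertAll` = stmt-PneNP-19683; planner p1 g14, `lines/osh-P2.md` F4: "G2(y) := |y| − def_Y(y) ≥ 0 (echelon split of a maximal
flat W at y: its vectors with leads in Z(y) span an increasing subflat of dim ≥ dim W − |L(W) ∩ supp y|)"; restricted-model combinatorics — nothing here bears on
`P` versus `NP`)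

* `finrank_le_card_of_leads` — a subspace all of whose non-zero vectors have their leading one inside `P` has dimension `≤ #P` (echelon pivots);
* `finrank_le_lexIncr` — a lex-increasing linear flat at `y` inside `Y` has dimension `≤ a_lex(y)`;
* `dimAt_le_lexIncr_add_card_supp` — **G2 ≥ 0: `dim_Y(y) ≤ a_lex(y) + |supp y|`** (`ClusHilbertEchelon.lex_split` of a maximal flat);
* `card_supp_add_card_zeros` — `|supp y| + z(y) = N`; hence with F4/G1 (`ClusOshTau`) the GAP FORM of the one-block rung is expressible pointwise.
-/

set_option linter.dupNamespace false -- `Summit.PneNP.PneNP.…`: summit = sub-problem name (D-0017 single-conjunct layout)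

namespace Summit.PneNP.PneNP.Theorems.ClusHilbert.Osh

open Finset
open Summit.PneNP.PneNP.Theorems.ClusCube (V)
open Summit.PneNP.PneNP.Theorems.ClusHilbert (dimAt lexRank exists_echelon lex_split lexRank_lt_of_lead_zero exists_direction)

variable {N : ℕ}

/-- **A subspace whose non-zero vectors all lead inside `P` has dimension at most `#P`.** -/
theorem finrank_le_card_of_leads (U : Submodule (ZMod 2) (V N)) (P : Finset (Fin N))
    (hU : ∀ u ∈ U, u ≠ 0 → ∃ t, (∀ i, i < t → u i = 0) ∧ u t ≠ 0 ∧ t ∈ P) : Module.finrank (ZMod 2) U ≤ P.card := by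
  classical
  obtain ⟨L, b, hb, hspan⟩ := exists_echelon U
  -- the pivots lie in `P`
  have hLP : L ⊆ P := by
    intro t ht
    obtain ⟨hbt, h0, h1⟩ := hb t ht
    obtain ⟨t', h0', h1', hP⟩ := hU (b t) hbt (fun h => by rw [h] at h1; exact zero_ne_one h1)
    have htt : t' = t := by
      by_contra hne
      rcases lt_or_gt_of_ne hne with hlt | hgt
      · exact h1' (h0 t' hlt)
      · have := h0' t hgt; rw [h1] at this; exact one_ne_zero this
    rw [← htt]; exact hP
  -- `U` is spanned by the `#L` pivots
  have hle : U ≤ Submodule.span (ZMod 2) (Set.range fun t : L => b t.1) := by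
    intro u hu
    obtain ⟨c, rfl⟩ := hspan u hu
    refine Submodule.sum_mem _ fun t ht => Submodule.smul_mem _ _ (Submodule.subset_span ⟨⟨t, ht⟩, rfl⟩)
  calc Module.finrank (ZMod 2) U ≤ Module.finrank (ZMod 2) (Submodule.span (ZMod 2) (Set.range fun t : L => b t.1)) := Submodule.finrank_mono hle
    _ ≤ Fintype.card L := finrank_range_le_card _
    _ = L.card := Fintype.card_coe L
    _ ≤ P.card := card_le_card hLP

/-- **A lex-increasing linear flat at `y` inside `Y` has dimension at most `a_lex(y)`.** -/
theorem finrank_le_lexIncr (Y : Finset (V N)) (y : V N) (U : Submodule (ZMod 2) (V N)) (hY : ∀ u ∈ U, y + u ∈ Y)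
    (hinc : ∀ u ∈ U, u ≠ 0 → lexRank y < lexRank (y + u)) : Module.finrank (ZMod 2) U ≤ lexIncr Y y := by
  unfold lexIncr
  refine le_csSup ⟨N, fun k ⟨U', hU', _, _⟩ => by
    rw [← hU']; exact (Submodule.finrank_le U').trans (by rw [Module.finrank_pi, Fintype.card_fin])⟩ ?_
  exact ⟨U, rfl, hY, hinc⟩

/-- **G2 ≥ 0: `dim_Y(y) ≤ a_lex(y) + |supp y|`.** -/
theorem dimAt_le_lexIncr_add_card_supp (Y : Finset (V N)) {y : V N} (hy : y ∈ Y) : dimAt Y y ≤ lexIncr Y y + (supp y).card := by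
  obtain ⟨W, hW, hk⟩ := exists_direction Y hy
  obtain ⟨U₁, U₂, h1, h2, hdim, hU₁, hU₂⟩ := lex_split y W
  have ha : Module.finrank (ZMod 2) U₁ ≤ lexIncr Y y :=
    finrank_le_lexIncr Y y U₁ (fun u hu => hW u (h1 hu)) fun u hu hu0 => by
      obtain ⟨t, hz, ht, hyt⟩ := hU₁ u hu hu0
      exact lexRank_lt_of_lead_zero hz ht hyt
  have hb : Module.finrank (ZMod 2) U₂ ≤ (supp y).card :=
    finrank_le_card_of_leads U₂ (supp y) fun u hu hu0 => by
      obtain ⟨t, hz, ht, hyt⟩ := hU₂ u hu hu0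
      refine ⟨t, hz, ht, ?_⟩
      unfold supp; exact mem_filter.2 ⟨mem_univ _, hyt⟩
  rw [← hk]
  omega

/-- `|supp y| + z(y) = N`. -/
theorem card_supp_add_card_zeros (y : V N) : (supp y).card + (zeros y).card = N := by
  classical
  unfold supp zeros
  have h := card_filter_add_card_filter_not (s := (univ : Finset (Fin N))) (fun i => y i = 0)
  rw [card_univ, Fintype.card_fin] at h
  have e : (univ.filter fun i => ¬ y i = 0) = univ.filter fun i => y i ≠ 0 := rfl
  rw [e] at h
  omega

end Summit.PneNP.PneNP.Theorems.ClusHilbert.Osh
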